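import Literature.Analysis.FluidPDE.SelfSimilarEulerProfile
import Literature.Analysis.FluidPDE.SelfSimilarEulerOutgoingExclusionTools
import HarnessLib

/-!
# Closed orbits of the self-similar Lagrangian flow force `γ = ½`
# (Constantin–Ignatova–Vicol 2026, Remark 3.6 / Theorem 4.4 without axisymmetry)

Analysis/FluidPDE proof file (theorems only; no definitions, no named facts, no `sorry`).

P. Constantin, M. Ignatova, V. Vicol, *On putative self-similarity for incompressible 3D Euler*
(arXiv:2602.17570), §3.4.2, prove the self-similar Kelvin theorem `e^{(1−2γ)τ} Γ(τ) = Γ(0)` for the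
circulation of the profile along loops transported by the self-similar Lagrangian flow
`dY/dτ = V(Y)`, `V = γ(y − c) + U` (tree: `selfSimilarTransport`), and remark (Rem. 3.6) that a loop with
non-zero circulation which stays bounded forces `γ = ½`; their Theorem 4.4 is the AXISYMMETRIC instance — a
fixed point of the meridional flow with non-zero swirl carries an invariant circle, i.e. a periodic orbit of
the full flow, whence `γ = ½` (tree: `SelfSimilarEulerSwirlingFixedPoint.lean`).  The general statement behind
it needs no symmetry and no Lagrangian flow map: along ANY trajectory the self-similar Bernoulli function
`ℋ = ½|V|² + P + ½γ(γ−1)|y−c|²` satisfies `dℋ(Y(τ))/dτ = V·∇ℋ = (2γ − 1)|V(Y(τ))|²` (CIV (3.31), tree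
`IsSelfSimilarEulerProfile.fderiv_selfSimilarBernoulli_transport`), a function of constant sign; so a
trajectory that RETURNS to its starting point consists of stagnation points:

* `IsSelfSimilarEulerProfile.transport_eq_zero_of_closed_orbit` — **for `γ ≠ ½`, every closed orbit of
  the self-similar Lagrangian flow is a stagnation point**: if `Y : ℝ → ℝ³` solves `Y' = V(Y)` and
  `Y(T) = Y(0)` for some `T > 0`, then `V(Y(t)) = 0` for all `t ∈ [0, T]` (no periodic orbits, no homoclinic
  excursions returning in finite time; the recirculating («non-outgoing», CIV Def. 3.7) part of an in-window
  profile's flow is GRADIENT-LIKE: trapped trajectories can only accumulate on the nodal set `𝒩_V`);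
* `IsSelfSimilarEulerProfile.gamma_eq_half_of_closed_orbit` — contrapositive in CIV's form: a closed orbit
  through a non-stagnation point forces `γ = ½` (Theorem 4.4 is the case of the invariant circle
  `r = r_*, z = z_*` of an axisymmetric profile with `U_θ(r_*, z_*) ≠ 0`);
* `IsSelfSimilarEulerProfile.not_closed_orbit_of_window` — in the Chae–Shvydkoy window `γ < ½`
  (velocity exponent `α = 1+ρ ∈ (1, 3/2]`, route `NavierStokesRegularity/EulerZoomLiouville`, rung C1): a
  trajectory through a non-stagnation point never returns.  KILL-TEST reading for candidate refuting
  profiles of the crux `PowerGaugeEulerLiouville` (stmt-NavierStokesRegularity-19832): exhibit one closed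
  streamline of `γy + U` avoiding `𝒩_V` and the candidate is dead.

Scope: `C²`/`C¹` regularity is that of `IsSelfSimilarEulerProfile`; only differentiability of `ℋ` along the
orbit is used.  Nothing here concerns existence of profiles or Navier–Stokes.
-/

noncomputable section

open Set Filter Topology InnerProductSpace Metric
open scoped RealInnerProductSpace

namespace Literature.Analysis.FluidPDE

namespace IsSelfSimilarEulerProfile

variable {γ : ℝ} {c : EuclideanSpace ℝ (Fin 3)}
  {U : EuclideanSpace ℝ (Fin 3) → EuclideanSpace ℝ (Fin 3)} {P : EuclideanSpace ℝ (Fin 3) → ℝ}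

/-- **Closed orbits of the self-similar Lagrangian flow are stagnation points (`γ ≠ ½`).**  Let `(U, P)`
be a self-similar Euler profile (CIV (3.3)) with exponent `γ ≠ ½` and let `Y : ℝ → ℝ³` be a trajectory of
`V = γ(y − c) + U`, `Y'(t) = V(Y(t))` for all `t`, with `Y(T) = Y(0)` for some `T > 0`.  Then `V(Y(t)) = 0`
for every `t ∈ [0, T]`.  Proof: `G = (2γ−1)·ℋ∘Y` has derivative `(2γ−1)²|V(Y)|² ≥ 0` (CIV (3.31)), is
therefore monotone on `[0,T]` with equal end values, hence constant; so its derivative vanishes on `(0,T)`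
and by continuity `V ∘ Y = 0` on `[0,T]`.
[cite: ConstantinIgnatovaVicol2026Putative, §3.4.2 Rem. 3.6 and §4.3 Thm. 4.4 (axisymmetric case)] -/
theorem transport_eq_zero_of_closed_orbit (h : IsSelfSimilarEulerProfile γ c U P) (hγ : γ ≠ 1 / 2)
    {Y : ℝ → EuclideanSpace ℝ (Fin 3)} (hY : ∀ t, HasDerivAt Y (selfSimilarTransport γ c U (Y t)) t)
    {T : ℝ} (hT : 0 < T) (hclosed : Y T = Y 0) :
    ∀ t ∈ Icc 0 T, selfSimilarTransport γ c U (Y t) = 0 := by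
  have hHd : Differentiable ℝ (selfSimilarBernoulli γ c U P) :=
    (contDiff_selfSimilarBernoulli h).differentiable one_ne_zero
  -- `G = (2γ-1) ℋ∘Y` and its derivative `(2γ-1)² |V∘Y|²`
  have hGd : ∀ t, HasDerivAt (fun s => (2 * γ - 1) * selfSimilarBernoulli γ c U P (Y s))
      ((2 * γ - 1) ^ 2 * ‖selfSimilarTransport γ c U (Y t)‖ ^ 2) t := by
    intro t
    have h1 : HasDerivAt (fun s => selfSimilarBernoulli γ c U P (Y s))
        (fderiv ℝ (selfSimilarBernoulli γ c U P) (Y t) (selfSimilarTransport γ c U (Y t))) t :=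
      (hHd (Y t)).hasFDerivAt.comp_hasDerivAt t (hY t)
    rw [h.fderiv_selfSimilarBernoulli_transport (Y t)] at h1
    exact (h1.const_mul (2 * γ - 1)).congr_deriv (by ring)
  have hYc : Continuous Y := continuous_iff_continuousAt.2 fun t => (hY t).continuousAt
  have hGc : Continuous fun s => (2 * γ - 1) * selfSimilarBernoulli γ c U P (Y s) :=
    continuous_const.mul (hHd.continuous.comp hYc)
  -- `G` is monotone on `[0, T]`, with equal end values, hence constant
  have hmono : MonotoneOn (fun s => (2 * γ - 1) * selfSimilarBernoulli γ c U P (Y s)) (Icc 0 T) :=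
    monotoneOn_of_hasDerivWithinAt_nonneg (convex_Icc 0 T) hGc.continuousOn
      (fun t _ => (hGd t).hasDerivWithinAt) fun t _ => by positivity
  have hconst : ∀ t ∈ Icc 0 T, (2 * γ - 1) * selfSimilarBernoulli γ c U P (Y t) =
      (2 * γ - 1) * selfSimilarBernoulli γ c U P (Y 0) := by
    intro t ht
    have h1 := hmono (left_mem_Icc.2 hT.le) ht ht.1
    have h2 := hmono ht (right_mem_Icc.2 hT.le) ht.2
    simp only [hclosed] at h2
    exact le_antisymm (by simpa using h2) (by simpa using h1)
  -- so its derivative vanishes on `(0, T)`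
  have hzero : ∀ t ∈ Ioo 0 T, selfSimilarTransport γ c U (Y t) = 0 := by
    intro t ht
    have hev : (fun s => (2 * γ - 1) * selfSimilarBernoulli γ c U P (Y s)) =ᶠ[𝓝 t]
        fun _ => (2 * γ - 1) * selfSimilarBernoulli γ c U P (Y 0) := by
      filter_upwards [Ioo_mem_nhds ht.1 ht.2] with s hs
      exact hconst s (Ioo_subset_Icc_self hs)
    have hD0 : HasDerivAt (fun s => (2 * γ - 1) * selfSimilarBernoulli γ c U P (Y s)) 0 t :=
      (hasDerivAt_const t _).congr_of_eventuallyEq hev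
    have huniq := (hGd t).unique hD0
    have h2 : (2 * γ - 1) ^ 2 ≠ 0 := by
      apply pow_ne_zero
      intro h0; apply hγ; linarith
    have h3 : ‖selfSimilarTransport γ c U (Y t)‖ ^ 2 = 0 := by
      rcases mul_eq_zero.1 huniq with h4 | h4
      · exact absurd h4 h2
      · exact h4
    exact norm_eq_zero.1 (pow_eq_zero_iff two_ne_zero |>.1 h3)
  -- and by continuity on `[0, T]`
  have hVc : Continuous fun t => selfSimilarTransport γ c U (Y t) := by
    have : Continuous (selfSimilarTransport γ c U) := by
      have e : selfSimilarTransport γ c U = fun y => γ • (y - c) + U y := rfl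
      rw [e]
      exact ((continuous_id.sub continuous_const).const_smul γ).add h.contDiff_velocity.continuous
    exact this.comp hYc
  have hclosedZ : IsClosed {t : ℝ | selfSimilarTransport γ c U (Y t) = 0} :=
    isClosed_eq hVc continuous_const
  have hsub : Icc 0 T ⊆ {t : ℝ | selfSimilarTransport γ c U (Y t) = 0} := by
    rw [← closure_Ioo hT.ne, hclosedZ.closure_subset_iff]
    exact hzero
  exact fun t ht => hsub ht

/-- **A closed orbit through a non-stagnation point forces `γ = ½`** (CIV 2026 Thm. 4.4 without the
axisymmetry: there the orbit is the circle through a meridional fixed point with non-zero swirl).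
[cite: ConstantinIgnatovaVicol2026Putative, §4.3 Thm. 4.4 (generalised: no symmetry)] -/
theorem gamma_eq_half_of_closed_orbit (h : IsSelfSimilarEulerProfile γ c U P)
    {Y : ℝ → EuclideanSpace ℝ (Fin 3)} (hY : ∀ t, HasDerivAt Y (selfSimilarTransport γ c U (Y t)) t)
    {T : ℝ} (hT : 0 < T) (hclosed : Y T = Y 0) (hmove : Y 0 ∉ selfSimilarNodalSet γ c U) :
    γ = 1 / 2 := by
  by_contra hγ
  exact hmove (transport_eq_zero_of_closed_orbit h hγ hY hT hclosed 0 (left_mem_Icc.2 hT.le))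

/-- **In the window `γ < ½` a trajectory through a non-stagnation point never returns** (no periodic
orbits, no closed streamlines of `γ(y−c) + U` off the nodal set).  Kill-test form for candidate refuting
profiles of the crux `NavierStokesRegularity/EulerZoomLiouville.PowerGaugeEulerLiouville`
(`γ = 1/(2+ρ) ∈ [2/5, ½)`). [cite: ConstantinIgnatovaVicol2026Putative, §3.4.2 Rem. 3.6] -/
theorem not_closed_orbit_of_window (h : IsSelfSimilarEulerProfile γ c U P) (hγ : γ < 1 / 2)
    {Y : ℝ → EuclideanSpace ℝ (Fin 3)} (hY : ∀ t, HasDerivAt Y (selfSimilarTransport γ c U (Y t)) t)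
    (hmove : Y 0 ∉ selfSimilarNodalSet γ c U) {T : ℝ} (hT : 0 < T) : Y T ≠ Y 0 :=
  fun hclosed => absurd (gamma_eq_half_of_closed_orbit h hY hT hclosed hmove) (ne_of_lt hγ)

/-- The same for the exponent of the route's class: `γ = 1/(2+ρ)` with `ρ > 0` (then `γ < ½`).
[cite: ConstantinIgnatovaVicol2026Putative, §3.4.2 Rem. 3.6 (window exponents `γ < ½`)] -/
theorem not_closed_orbit_of_exponent {ρ : ℝ} (hρ : 0 < ρ) (h : IsSelfSimilarEulerProfile (1 / (2 + ρ)) c U P)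
    {Y : ℝ → EuclideanSpace ℝ (Fin 3)}
    (hY : ∀ t, HasDerivAt Y (selfSimilarTransport (1 / (2 + ρ)) c U (Y t)) t)
    (hmove : Y 0 ∉ selfSimilarNodalSet (1 / (2 + ρ)) c U) {T : ℝ} (hT : 0 < T) : Y T ≠ Y 0 := by
  refine not_closed_orbit_of_window h ?_ hY hmove hT
  rw [div_lt_div_iff_of_pos_left one_pos (by linarith) (by norm_num)]
  linarith

end IsSelfSimilarEulerProfile

end Literature.Analysis.FluidPDE

end
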